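import Mathlib
import HarnessLib

/-!
# `KickFairRelEquilibriumMeso`, line `Sketch` — glue T, part (b): per-level-set density domination
# from a four-term density inequality

Helper file (`--supports stmt-AtomisticToContinuum-15177`) of the line lead for the registered glue stub
`stub_pinchTransfer`. The line compares the local Gibbs law `μ = L.withDensity f` with an invariant law
`ν = L.withDensity g` (same Liouville reference `L`) LEVEL SET BY LEVEL SET `B` of the time-zero key; the
static stub `stub_binOscillation` delivers the bill in the four-term form
`f z * g z' ≤ Λ * (f z' * g z)` for `z, z' ∈ B` (the oscillation of `log (f/g)` over `B` is `≤ log Λ`,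
written without quotients so that both sides may vanish off the hard-sphere domain). This file turns the
four-term inequality into the transfer inequality the glue consumes:

* `lintegral_mul_lintegral_le_of_fourTerm` — `(∫_B g dL) · ∫_B F f dL ≤ Λ · (∫_B f dL) · ∫_B F g dL` for
  every measurable `F ≥ 0` (Tonelli on `B × B` and the pointwise inequality);
* `withDensity_mul_setLIntegral_le_of_fourTerm` — the same in measure form:
  `ν(B) · ∫_B F dμ ≤ Λ · μ(B) · ∫_B F dν`, i.e. CONDITIONALLY ON `B` the law `μ` is dominated by `Λ` times
  the law `ν` — with `log Λ = o(N)` a sub-exponential loss, beaten by any speed-`N` concentration under `ν`.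
-/

noncomputable section

open MeasureTheory Set
open scoped ENNReal

namespace Summit.AtomisticToContinuum.HydrodynamicLimit.Theorems.KickFairRelEquilibriumMesoLine

variable {α : Type*} [MeasurableSpace α]

/-- **Tonelli form of the per-level-set domination.** If `f z * g z' ≤ Λ * (f z' * g z)` for all `z, z'` in a
measurable set `B`, then for every measurable `F ≥ 0`:
`(∫_B g) · ∫_B F·f ≤ Λ · (∫_B f) · ∫_B F·g` (all integrals against the same reference measure `L`). [folklore] -/
theorem lintegral_mul_lintegral_le_of_fourTerm (L : Measure α) {f g F : α → ℝ≥0∞} (hf : Measurable f)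
    (hg : Measurable g) (hF : Measurable F) {B : Set α} (hB : MeasurableSet B) {Λ : ℝ≥0∞}
    (hdom : ∀ z ∈ B, ∀ z' ∈ B, f z * g z' ≤ Λ * (f z' * g z)) :
    (∫⁻ z in B, g z ∂L) * ∫⁻ z in B, F z * f z ∂L ≤ Λ * (∫⁻ z in B, f z ∂L) * ∫⁻ z in B, F z * g z ∂L := by
  -- write both sides as double integrals over `B × B`
  have hL : (∫⁻ z in B, g z ∂L) * ∫⁻ z in B, F z * f z ∂L =
      ∫⁻ z in B, ∫⁻ z' in B, F z * f z * g z' ∂L ∂L := by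
    have h1 : (∫⁻ z in B, F z * f z ∂L) * (∫⁻ z in B, g z ∂L) =
        ∫⁻ z in B, (F z * f z) * (∫⁻ z' in B, g z' ∂L) ∂L :=
      (lintegral_mul_const (μ := L.restrict B) (∫⁻ z in B, g z ∂L) (hF.mul hf)).symm
    have h2 : ∀ z, (F z * f z) * (∫⁻ z' in B, g z' ∂L) = ∫⁻ z' in B, F z * f z * g z' ∂L := fun z =>
      (lintegral_const_mul (μ := L.restrict B) (F z * f z) hg).symm
    rw [mul_comm, h1]
    exact lintegral_congr fun z => h2 z
  have hR : Λ * (∫⁻ z in B, f z ∂L) * ∫⁻ z in B, F z * g z ∂L =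
      ∫⁻ z in B, ∫⁻ z' in B, Λ * (F z * g z) * f z' ∂L ∂L := by
    have h1 : (∫⁻ z in B, Λ * (F z * g z) ∂L) * (∫⁻ z in B, f z ∂L) =
        ∫⁻ z in B, (Λ * (F z * g z)) * (∫⁻ z' in B, f z' ∂L) ∂L :=
      (lintegral_mul_const (μ := L.restrict B) (∫⁻ z in B, f z ∂L) ((hF.mul hg).const_mul Λ)).symm
    have h2 : ∀ z, (Λ * (F z * g z)) * (∫⁻ z' in B, f z' ∂L) = ∫⁻ z' in B, Λ * (F z * g z) * f z' ∂L :=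
      fun z => (lintegral_const_mul (μ := L.restrict B) (Λ * (F z * g z)) hf).symm
    have h3 : Λ * ∫⁻ z in B, F z * g z ∂L = ∫⁻ z in B, Λ * (F z * g z) ∂L :=
      (lintegral_const_mul (μ := L.restrict B) Λ (hF.mul hg)).symm
    rw [mul_assoc, mul_comm (∫⁻ z in B, f z ∂L), ← mul_assoc, h3, h1]
    exact lintegral_congr fun z => h2 z
  rw [hL, hR]
  -- pointwise comparison on `B × B` (no measurability needed for `lintegral_mono_ae`)
  refine lintegral_mono_ae ?_
  filter_upwards [ae_restrict_mem hB] with z hz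
  refine lintegral_mono_ae ?_
  filter_upwards [ae_restrict_mem hB] with z' hz'
  calc F z * f z * g z' = F z * (f z * g z') := by ring
    _ ≤ F z * (Λ * (f z' * g z)) := mul_le_mul_right (hdom z hz z' hz') _
    _ = Λ * (F z * g z) * f z' := by ring

/-- **Measure form of the per-level-set domination.** With `μ = L.withDensity f`, `ν = L.withDensity g` and
the four-term inequality on `B`: `ν(B) · ∫_B F dμ ≤ Λ · μ(B) · ∫_B F dν` for every measurable `F ≥ 0` —
conditionally on the level set `B`, `μ` is dominated by `Λ` times `ν`. [folklore] -/
theorem withDensity_mul_setLIntegral_le_of_fourTerm (L : Measure α) {f g F : α → ℝ≥0∞}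
    (hf : Measurable f) (hg : Measurable g) (hF : Measurable F) {B : Set α} (hB : MeasurableSet B)
    {Λ : ℝ≥0∞} (hdom : ∀ z ∈ B, ∀ z' ∈ B, f z * g z' ≤ Λ * (f z' * g z)) :
    L.withDensity g B * ∫⁻ z in B, F z ∂(L.withDensity f) ≤
      Λ * L.withDensity f B * ∫⁻ z in B, F z ∂(L.withDensity g) := by
  rw [withDensity_apply _ hB, withDensity_apply _ hB,
    setLIntegral_withDensity_eq_setLIntegral_mul _ hf hF hB,
    setLIntegral_withDensity_eq_setLIntegral_mul _ hg hF hB]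
  have h1 : ∫⁻ z in B, (f * F) z ∂L = ∫⁻ z in B, F z * f z ∂L :=
    lintegral_congr fun z => by simp [mul_comm]
  have h2 : ∫⁻ z in B, (g * F) z ∂L = ∫⁻ z in B, F z * g z ∂L :=
    lintegral_congr fun z => by simp [mul_comm]
  rw [h1, h2]
  exact lintegral_mul_lintegral_le_of_fourTerm L hf hg hF hB hdom

/-- **Registered sub-goal `transferDomination` of the glue (T-b)** (the measure form above, stated over a
`Type`-valued phase space with all binders after the colon). [folklore] -/
theorem transferDomination : ∀ (β : Type) (mβ : MeasurableSpace β) (L : Measure β) (f g F : β → ℝ≥0∞)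
    (B : Set β) (Λ : ℝ≥0∞), Measurable f → Measurable g → Measurable F → MeasurableSet B →
    (∀ z ∈ B, ∀ z' ∈ B, f z * g z' ≤ Λ * (f z' * g z)) →
    L.withDensity g B * ∫⁻ z in B, F z ∂(L.withDensity f) ≤
      Λ * L.withDensity f B * ∫⁻ z in B, F z ∂(L.withDensity g) :=
  fun _ _ L _ _ _ _ _ hf hg hF hB hdom => withDensity_mul_setLIntegral_le_of_fourTerm L hf hg hF hB hdom

end Summit.AtomisticToContinuum.HydrodynamicLimit.Theorems.KickFairRelEquilibriumMesoLine

end
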